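import Mathlib

/-!
# Affine systems over `F₂^d`: fibre counts and the number of independent tuples

Helper file (1/8) for the REFUTATION of the registered stub `stub_biDenseTrapSparse` of crux
stmt-PneNP-9818 (`RamseyUncertifiable.RegularResolutionRung`, dead line `sound-path-bottleneck`;
dossier `Cruxes/RegularResolutionRung/Lines/sound-path-bottleneck-dead.md`). The witness is the
points/affine-hyperplanes graph over `F₂^d`; this file supplies the linear algebra it needs, over the
vector space `Vec d := Fin d → ZMod 2`:

* `card_solSet`: if the rows of `A : Matrix (Fin s) (Fin d) (ZMod 2)` are linearly independent then every
  affine system `A x = c` has exactly `2^(d-s)` solutions (and `s ≤ d`);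
* `le_card_indepTuples`: the number of linearly independent `s`-tuples is at least `(2^d - 2^s)^s`.

[folklore]
-/

noncomputable section

open Finset Matrix Module
open scoped Classical

namespace Summit.PneNP.PneNP.Cruxes.RegularResolutionRung.SoundPathBottleneck.HadamardWitness

set_option linter.dupNamespace false -- `Summit.PneNP.PneNP.…`: single-conjunct summit (D-0017)

/-- The vector space `F₂^d`. -/
abbrev Vec (d : ℕ) := Fin d → ZMod 2

variable {d s : ℕ}

/-- The solution set of the affine system `A x = c`. -/
def solSet (A : Matrix (Fin s) (Fin d) (ZMod 2)) (c : Fin s → ZMod 2) : Finset (Vec d) :=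
  univ.filter fun x => A *ᵥ x = c

/-- Membership in `solSet`. -/
@[simp] theorem mem_solSet {A : Matrix (Fin s) (Fin d) (ZMod 2)} {c : Fin s → ZMod 2} {x : Vec d} :
    x ∈ solSet A c ↔ A *ᵥ x = c := by
  simp [solSet]

/-- The solution set of the homogeneous system is the kernel of `A.mulVecLin`, as a finset. -/
theorem card_solSet_zero (A : Matrix (Fin s) (Fin d) (ZMod 2)) :
    (solSet A 0).card = Nat.card (LinearMap.ker A.mulVecLin) := by
  classical
  rw [Nat.card_eq_fintype_card, Fintype.card_subtype]
  congr 1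
  ext x
  simp [solSet, LinearMap.mem_ker]

/-- **Fibre count.** If the rows of `A` are linearly independent, every affine system `A x = c` over
`F₂` has exactly `2^(d-s)` solutions, and `s ≤ d`. -/
theorem card_solSet (A : Matrix (Fin s) (Fin d) (ZMod 2)) (hA : LinearIndependent (ZMod 2) A.row)
    (c : Fin s → ZMod 2) : (solSet A c).card = 2 ^ (d - s) ∧ s ≤ d := by
  classical
  have hrank : A.rank = s := by simpa using hA.rank_matrix
  have hfr : finrank (ZMod 2) (LinearMap.range A.mulVecLin) = s := hrank
  have hsum := A.mulVecLin.finrank_range_add_finrank_ker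
  rw [hfr, finrank_pi, Fintype.card_fin] at hsum
  have hsd : s ≤ d := by omega
  have hker : finrank (ZMod 2) (LinearMap.ker A.mulVecLin) = d - s := by omega
  have htop : LinearMap.range A.mulVecLin = ⊤ := by
    apply Submodule.eq_top_of_finrank_eq
    rw [hfr, finrank_pi, Fintype.card_fin]
  refine ⟨?_, hsd⟩
  -- the fibre over `c` has the cardinality of the kernel
  have hc : c ∈ Set.range A.mulVecLin := by
    have : c ∈ LinearMap.range A.mulVecLin := htop ▸ Submodule.mem_top
    obtain ⟨x, hx⟩ := LinearMap.mem_range.1 this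
    exact ⟨x, hx⟩
  have h0 : (0 : Fin s → ZMod 2) ∈ Set.range A.mulVecLin := ⟨0, map_zero _⟩
  have hfib := AddMonoidHom.card_fiber_eq_of_mem_range A.mulVecLin.toAddMonoidHom hc h0
  have e1 : (solSet A c).card = (univ.filter fun g : Vec d => A.mulVecLin.toAddMonoidHom g = c).card := by
    unfold solSet; rfl
  have e2 : (solSet A 0).card = (univ.filter fun g : Vec d => A.mulVecLin.toAddMonoidHom g = 0).card := by
    unfold solSet; rfl
  rw [e1, hfib, ← e2, card_solSet_zero, Module.natCard_eq_pow_finrank (K := ZMod 2), Nat.card_zmod, hker]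

/-- For an arbitrary matrix the solution set of `A x = c` is empty or a translate of the kernel; in
particular, if the rows are linearly independent it has at most `2^(d-s)` elements (in fact exactly,
`card_solSet`), and for a SUB-system obtained by restricting to independent rows the count only grows.
We record the monotonicity we use: adding equations shrinks the solution set. -/
theorem solSet_subset_of_rows {t : ℕ} (A : Matrix (Fin s) (Fin d) (ZMod 2)) (c : Fin s → ZMod 2)
    (f : Fin t → Fin s) :
    solSet A c ⊆ solSet (A.submatrix f id) (c ∘ f) := by
  intro x hx
  rw [mem_solSet] at hx ⊢
  funext i
  have := congrFun hx (f i)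
  simpa [mulVec, dotProduct, Matrix.submatrix] using this

/-- The span of a linearly independent `s`-tuple has `2^s` elements. -/
theorem card_span_of_linearIndependent (v : Fin s → Vec d) (hv : LinearIndependent (ZMod 2) v) :
    (univ.filter fun x : Vec d => x ∈ Submodule.span (ZMod 2) (Set.range v)).card = 2 ^ s := by
  classical
  have h1 : Nat.card (Submodule.span (ZMod 2) (Set.range v)) = 2 ^ s := by
    rw [Module.natCard_eq_pow_finrank (K := ZMod 2), Nat.card_zmod, finrank_span_eq_card hv,
      Fintype.card_fin]
  rw [← h1, Nat.card_eq_fintype_card, Fintype.card_subtype]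

/-- The number of vectors outside the span of a linearly independent `s`-tuple is `2^d - 2^s`. -/
theorem card_not_mem_span (v : Fin s → Vec d) (hv : LinearIndependent (ZMod 2) v) :
    (univ.filter fun x : Vec d => x ∉ Submodule.span (ZMod 2) (Set.range v)).card = 2 ^ d - 2 ^ s := by
  classical
  have htot : (univ : Finset (Vec d)).card = 2 ^ d := by simp
  have := Finset.card_filter_add_card_filter_not
    (s := (univ : Finset (Vec d))) (fun x : Vec d => x ∈ Submodule.span (ZMod 2) (Set.range v))
  rw [card_span_of_linearIndependent v hv, htot] at this
  omega

/-- The finset of linearly independent `s`-tuples of vectors of `F₂^d`. -/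
def indepTuples (d s : ℕ) : Finset (Fin s → Vec d) := by
  classical exact univ.filter fun v => LinearIndependent (ZMod 2) v

/-- Membership in `indepTuples`. -/
theorem mem_indepTuples {v : Fin s → Vec d} : v ∈ indepTuples d s ↔ LinearIndependent (ZMod 2) v := by
  classical
  unfold indepTuples
  simp

/-- Extension step: every independent `s`-tuple extends by any vector outside its span. -/
theorem card_indepTuples_succ_ge (d s : ℕ) :
    (indepTuples d s).card * (2 ^ d - 2 ^ s) ≤ (indepTuples d (s + 1)).card := by
  classical
  -- the sigma finset of pairs (v, x) with v independent and x ∉ span v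
  set S : Finset (Σ _ : Fin s → Vec d, Vec d) :=
    (indepTuples d s).sigma fun v => univ.filter fun x : Vec d => x ∉ Submodule.span (ZMod 2) (Set.range v)
    with hS
  have hScard : S.card = (indepTuples d s).card * (2 ^ d - 2 ^ s) := by
    rw [hS, Finset.card_sigma]
    rw [Finset.sum_const_nat (m := 2 ^ d - 2 ^ s)]
    intro v hv
    exact card_not_mem_span v ((mem_indepTuples).1 hv)
  rw [← hScard]
  -- the map (v, x) ↦ snoc v x is injective into independent (s+1)-tuples
  refine Finset.card_le_card_of_injOn (fun p => (Fin.snoc p.1 p.2 : Fin (s + 1) → Vec d)) ?_ ?_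
  · intro p hp
    simp only [hS, Finset.coe_sigma, Set.mem_sigma_iff, Finset.mem_coe, mem_indepTuples,
      Finset.mem_filter, Finset.mem_univ, true_and] at hp
    rw [Finset.mem_coe, mem_indepTuples]
    exact linearIndependent_finSnoc.2 ⟨hp.1, hp.2⟩
  · intro p _ q _ hpq
    have h1 : p.1 = q.1 := by
      have := congrArg Fin.init hpq
      simpa using this
    have h2 : p.2 = q.2 := by
      have := congrFun hpq (Fin.last s)
      simpa using this
    exact Sigma.ext h1 (heq_of_eq h2)

/-- **Counting independent tuples.** At least `(2^d - 2^s)^s` ordered `s`-tuples of vectors of `F₂^d`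
are linearly independent. -/
theorem le_card_indepTuples (d s : ℕ) : (2 ^ d - 2 ^ s) ^ s ≤ (indepTuples d s).card := by
  classical
  -- stronger: ∏_{i<s} (2^d - 2^i) ≤ card, by induction, then compare termwise
  suffices h : ∀ t, t ≤ s → (2 ^ d - 2 ^ s) ^ t ≤ (indepTuples d t).card from h s le_rfl
  intro t
  induction t with
  | zero =>
    intro _
    have : (indepTuples d 0).card = 1 := by
      rw [Finset.card_eq_one]
      refine ⟨fun i => Fin.elim0 i, ?_⟩
      ext v
      simp only [mem_indepTuples, Finset.mem_singleton]
      constructor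
      · intro _; funext i; exact Fin.elim0 i
      · intro _; exact linearIndependent_empty_type
    simp [this]
  | succ t ih =>
    intro hts
    have ih' := ih (by omega)
    have hstep := card_indepTuples_succ_ge d t
    have hmono : 2 ^ d - 2 ^ s ≤ 2 ^ d - 2 ^ t := by
      have : 2 ^ t ≤ 2 ^ s := Nat.pow_le_pow_right (by norm_num) (by omega)
      omega
    calc (2 ^ d - 2 ^ s) ^ (t + 1) = (2 ^ d - 2 ^ s) ^ t * (2 ^ d - 2 ^ s) := pow_succ _ _
      _ ≤ (indepTuples d t).card * (2 ^ d - 2 ^ t) := Nat.mul_le_mul ih' hmono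
      _ ≤ (indepTuples d (t + 1)).card := hstep

/-- Anchor (registered sub-goal `hw_linAlg_anchor` of stmt-PneNP-9818): the count of independent tuples. -/
theorem hw_linAlg_anchor : ∀ d s : ℕ, (2 ^ d - 2 ^ s) ^ s ≤ (indepTuples d s).card := le_card_indepTuples

end Summit.PneNP.PneNP.Cruxes.RegularResolutionRung.SoundPathBottleneck.HadamardWitness

end
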